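import Mathlib

/-!
# PercRepro — C-025 at `(6,4)`, §22.12: the COARSE PROFILE LIST of the plane-line case and its finite check (p3, gen 9)

mine-2's `MINE2-RLS.md` §22.12 (the §22.6 statement in finite profile-list form; `planeline_coarse.py`, ref-1 concur
2026-08-22T20:32Z): a plane-line solid `G` (all planes `≤ 7` points, `10 ≤ g`, not generic) has a COARSE PROFILE
`π = (case, p, n, (inc₂, …, inc₇), (s_j))` — the case skew / meeting, the sizes `p = |ρ|` of the distinguished plane
trace and `n = |L|` of the collinear rest, the line-size vector of `ρ` and the class sizes — and the balance `J₄(G)`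
is bounded below by the closed form `Jlow(π)` (Theorem 22.12).  This file is the PURE DATA SIDE:

* `ch`, `delta`, `eps`, `F5 = 5·F`, `bonus5 = 5·bonus`, `cost5 = 5·cost_g` (kernel-friendly: factorial binomials,
  everything scaled to integers);
* `CProf` and the plane list `planes π` of 22.12.4 (`ρ`; `Π_j`; the `{x} ∪ λ` for the non-class lines), the line counts
  `b π m`, `lpp π` (the identity 22.2 on the list), the covering-pair bound `Xbar π` of Lemma 22.12.3, and
  `J15 π = 15·Jlow(π) = 3·5F − 3·5cost + 3·5bonus + 10·lpp − 18·Xbar`;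
* `LIST`, the 829 tuples of 22.12.5 (the arithmetic constraints only — a SUPERSET of the realised profiles), by a
  bounded enumeration mirroring `coarse_list()`;
* the kernel checks `LIST_length : LIST.length = 829` and `LIST_pos : every π ∈ LIST has 0 < J15 π`
  (`decide +kernel`, no `native_decide`; minimum `1976`), with `J15_pos_of_mem`.

The matroid side — every plane-line solid has a profile in `LIST` with `Jlow(π) ≤ J₄(G)` — is the Prop `PLBound` of
`SixFourPLBridge.lean`, which turns this check into `SixTwoSix`.  Cross-check: `data/mine-2/gen11/coarse_list_lean.tsv`
(829 rows; `15·Jlow` per row) — re-derived from these definitions in Python, 829/829 rows equal.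
-/

namespace PercRepro.SixFour.PL

/-! ## Kernel-friendly arithmetic -/

/-- Binomial coefficient through factorials (kernel-friendly). -/
def ch (n k : ℕ) : ℕ := if k ≤ n then n.factorial / (k.factorial * (n - k).factorial) else 0

/-- `δ(m) = 2^m − 1 − m − C(m,2) − C(m,3)`: the subsets of an `m`-set with at least `4` points. -/
def delta (m : ℕ) : ℕ := 2 ^ m - 1 - m - ch m 2 - ch m 3

/-- `ε(m) = 2^m − 1 − m − C(m,2)`: the subsets of an `m`-set with at least `3` points. -/
def eps (m : ℕ) : ℕ := 2 ^ m - 1 - m - ch m 2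

/-- `5·F(g) = 4·2^g + 2·(1 + g + C(g,2) + C(g,3)) − 8·C(g,4)`. -/
def F5 (g : ℕ) : ℤ := 4 * 2 ^ g + 2 * (1 + g + ch g 2 + ch g 3) - 8 * ch g 4

/-- `5·bonus(m) = 2·δ(m) + 8·C(m,4)`. -/
def bonus5 (m : ℕ) : ℤ := 2 * delta m + 8 * ch m 4

/-- A plane of the list: `q` points, line-size multiset as `(size, count)` pairs (2-point lines included), and the
multiplicity with which it occurs in the list. -/
structure Pl where
  /-- the number of points -/
  q : ℕ
  /-- the line sizes with their counts -/
  lines : List (ℕ × ℕ)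
  /-- the multiplicity in the list -/
  mult : ℕ

/-- `D₃(P) = δ(q) − Σ_λ δ(m_λ)`. -/
def D3 (P : Pl) : ℤ := (delta P.q : ℤ) - (P.lines.map fun mc => (delta mc.1 : ℤ) * mc.2).sum

/-- `r₃₄(P) = C(q,4) − Σ_λ C(m_λ,4)`. -/
def r34 (P : Pl) : ℤ := (ch P.q 4 : ℤ) - (P.lines.map fun mc => (ch mc.1 4 : ℤ) * mc.2).sum

/-- `5·cost_g(P) = (5(g − q) − 2)·D₃(P) − 8·r₃₄(P)`. -/
def cost5 (g : ℕ) (P : Pl) : ℤ := (5 * ((g : ℤ) - P.q) - 2) * D3 P - 8 * r34 P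

/-- The number of lines of size `m` of a list plane. -/
def Lcount (P : Pl) (m : ℕ) : ℕ := ((P.lines.filter fun mc => mc.1 = m).map fun mc => mc.2).sum

/-! ## Coarse profiles and the closed form -/

/-- A coarse profile: the case (`meet = true` for the meeting case), `p = |ρ|`, `n = |L|`, the line-size vector
`inc₂ … inc₇` of `ρ` (2-point lines included) and the class sizes `s_j`. -/
structure CProf where
  /-- meeting case (`ℓ′ ∩ ρ = {z}`) or skew case -/
  meet : Bool
  /-- `p = |ρ|` -/
  p : ℕ
  /-- `n = |L|` -/
  n : ℕ
  /-- `inc₂, …, inc₇` -/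
  inc : List ℕ
  /-- the class sizes -/
  sizes : List ℕ
deriving DecidableEq

/-- `inc_m` (`0` outside `2 ≤ m ≤ 7`). -/
def incOf (π : CProf) (m : ℕ) : ℕ := if 2 ≤ m then π.inc.getD (m - 2) 0 else 0

/-- `e = [meet]`. -/
def e (π : CProf) : ℕ := if π.meet then 1 else 0

/-- `g = p + n`. -/
def g (π : CProf) : ℕ := π.p + π.n

/-- `|ℓ′| = n + e`. -/
def lprime (π : CProf) : ℕ := π.n + e π

/-- `ν_m`: the non-class lines of `ρ` of size `m` (`inc_m − #{j : s_j = m}`). -/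
def nu (π : CProf) (m : ℕ) : ℕ := incOf π m - π.sizes.count m

/-- The plane list `𝒫(π)` of 22.12.4: `ρ`; `Π_j = ℓ′ ∪ λ_j` for each class; `n·ν_m` copies of `{x} ∪ λ` for the
non-class lines `λ` of size `m`. -/
def planes (π : CProf) : List Pl :=
  [⟨π.p, (List.range 6).map (fun i => (i + 2, incOf π (i + 2))), 1⟩] ++
  π.sizes.map (fun s =>
    if π.meet then ⟨π.n + s, [(π.n + 1, 1), (s, 1), (2, π.n * (s - 1))], 1⟩
    else ⟨π.n + s, [(π.n, 1), (s, if 2 ≤ s then 1 else 0), (2, π.n * s)], 1⟩) ++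
  (List.range 6).map (fun i =>
    ⟨i + 3, if 2 < i + 2 then [(i + 2, 1), (2, i + 2)] else [(2, 3)], π.n * nu π (i + 2)⟩)

/-- The line counts `b_m(π)`: `ℓ′`, the lines of `ρ`, and the `n·(p − e)` two-point lines across `ρ` and `L`. -/
def b (π : CProf) (m : ℕ) : ℕ :=
  (if m = lprime π then 1 else 0) + incOf π m + (if m = 2 then π.n * (π.p - e π) else 0)

/-- `5·Σ_{P ∈ 𝒫(π)} cost_g(P)`. -/
def cost5sum (π : CProf) : ℤ := ((planes π).map fun P => (P.mult : ℤ) * cost5 (g π) P).sum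

/-- `5·Σ_m b_m(π)·bonus(m)`. -/
def bonus5sum (π : CProf) : ℤ := ((List.range 6).map fun i => (b π (i + 2) : ℤ) * bonus5 (i + 2)).sum

/-- `lpp(π) = Σ_{m ≥ 3} ε(m)·[b_m·C(g − m, 2) − Σ_{P ∈ 𝒫(π)} inc(P, m)·C(|P| − m, 2)]`. -/
def lpp (π : CProf) : ℤ :=
  ((List.range 5).map fun i =>
    (eps (i + 3) : ℤ) * ((b π (i + 3) : ℤ) * ch (g π - (i + 3)) 2 -
      ((planes π).map fun P => (P.mult : ℤ) * Lcount P (i + 3) * ch (P.q - (i + 3)) 2).sum)).sum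

/-- The number of pairs `j < k` of a list satisfying a symmetric predicate. -/
def countPairs : List ℕ → (ℕ → ℕ → Bool) → ℕ
  | [], _ => 0
  | a :: l, f => (l.filter (f a)).length + countPairs l f

/-- The covering-pair bound `X̄(π) = 2·[Σ_j 2^{s_j} + 2^{n+e}·#{j < k : s_j + s_k − e = p} + 4n·#{j : ν_{p−s_j} + ν_{p−s_j+1} > 0}]`
of Lemma 22.12.3. -/
def Xbar (π : CProf) : ℕ :=
  2 * ((π.sizes.map fun s => 2 ^ s).sum +
    2 ^ lprime π * countPairs π.sizes (fun a b => a + b = π.p + e π) +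
    4 * π.n * (π.sizes.filter fun s => 0 < nu π (π.p - s) ∨ 0 < nu π (π.p - s + 1)).length)

/-- `15·Jlow(π) = 3·5F − 3·5cost + 3·5bonus + 10·lpp − 18·X̄`. -/
def J15 (π : CProf) : ℤ :=
  3 * F5 (g π) - 3 * cost5sum π + 3 * bonus5sum π + 10 * lpp π - 18 * Xbar π

/-! ## The list (22.12.5) -/

/-- The vectors `(inc₃, …, inc_{p−1})` with `inc_m ≤ C(p,2)/C(m,2)` (fuel `k = p − m` remaining entries). -/
def vecsAux (p : ℕ) : ℕ → ℕ → List (List ℕ)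
  | 0, _ => [[]]
  | k + 1, m => (List.range (ch p 2 / ch m 2 + 1)).flatMap fun v => (vecsAux p k (m + 1)).map (v :: ·)

/-- The candidate line-size vectors of a `p`-point plane trace. -/
def vecs (p : ℕ) : List (List ℕ) := vecsAux p (p - 3) 3

/-- `(inc₂, …, inc₇)` from `(inc₃, …, inc_{p−1})`: `inc_m = 0` for `m ≥ p`, `inc₂ = C(p,2) − Σ_{m ≥ 3} C(m,2)·inc_m`
(none when the pair count is exceeded). -/
def incFromVec (p : ℕ) (vec : List ℕ) : Option (List ℕ) :=
  let s2 := ((List.range vec.length).map fun i => ch (i + 3) 2 * vec.getD i 0).sum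
  if s2 ≤ ch p 2 then
    some ((ch p 2 - s2) :: (List.range 5).map (fun i => if i + 3 < p then vec.getD i 0 else 0))
  else none

/-- Skew class patterns: non-increasing lists of sizes `≥ 1`, each `≤ mx`, summing to `rem` (fuel first). -/
def parts : ℕ → ℕ → ℕ → List (List ℕ)
  | _, 0, _ => [[]]
  | 0, _ + 1, _ => []
  | f + 1, rem + 1, mx =>
    (List.range (min (rem + 1) mx)).flatMap fun i =>
      let s := min (rem + 1) mx - i
      (parts f (rem + 1 - s) s).map (s :: ·)

/-- Meeting class patterns: non-increasing lists of sizes `≥ 2`, each `≤ mx`, with `Σ (s_j − 1) = rem` (fuel first). -/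
def parts2 : ℕ → ℕ → ℕ → List (List ℕ)
  | _, 0, _ => [[]]
  | 0, _ + 1, _ => []
  | f + 1, rem + 1, mx =>
    (List.range (min (rem + 2) mx - 1)).flatMap fun i =>
      let s := min (rem + 2) mx - i
      (parts2 f (rem + 1 - (s - 1)) s).map (s :: ·)

/-- **The list of 22.12.5**: all coarse tuples allowed by the arithmetic constraints — `4 ≤ p ≤ 7`, the pair identity
of `ρ`, `3 ≤ n`, `n + e ≤ 6`, `10 ≤ g ≤ 13`, class sizes `≤ 7 − n` with the skew / meeting sum rules and
`#{j : s_j = m} ≤ inc_m`. -/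
def LIST : List CProf :=
  (List.range 4).flatMap fun pi =>
    let p := pi + 4
    (vecs p).flatMap fun vec =>
      match incFromVec p vec with
      | none => []
      | some inc =>
        [false, true].flatMap fun meet =>
          (List.range 4).flatMap fun ni =>
            let n := ni + 3
            let ee := if meet then 1 else 0
            if 10 ≤ p + n ∧ p + n ≤ 13 ∧ n + ee ≤ 6 then
              let ss := if meet then parts2 p (p - 1) (7 - n) else parts p p (7 - n)
              (ss.filter fun sizes => (List.range 6).all fun i => sizes.count (i + 2) ≤ inc.getD i 0).map
                fun sizes => ⟨meet, p, n, inc, sizes⟩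
            else []

set_option Elab.async false

/-- The list has `829` entries (22.12.5: `g = 10`: 388, `11`: 279, `12`: 131, `13`: 31). -/
theorem LIST_length : LIST.length = 829 := by decide +kernel

/-- The `k`-th block of `100` entries of the list (the finite check is done block by block: one `decide` over all
`829` entries exceeds the elaborator's recursion budget). -/
def chunk (k : ℕ) : List CProf := (LIST.drop (100 * k)).take 100

/-- block 0: `15·Jlow > 0` on entries `0..99`. -/
theorem chunk_0 : (chunk 0).all (fun π => decide (0 < J15 π)) = true := by decide +kernel
/-- block 1: `15·Jlow > 0` on entries `100..199`. -/
theorem chunk_1 : (chunk 1).all (fun π => decide (0 < J15 π)) = true := by decide +kernel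
/-- block 2: `15·Jlow > 0` on entries `200..299`. -/
theorem chunk_2 : (chunk 2).all (fun π => decide (0 < J15 π)) = true := by decide +kernel
/-- block 3: `15·Jlow > 0` on entries `300..399`. -/
theorem chunk_3 : (chunk 3).all (fun π => decide (0 < J15 π)) = true := by decide +kernel
/-- block 4: `15·Jlow > 0` on entries `400..499`. -/
theorem chunk_4 : (chunk 4).all (fun π => decide (0 < J15 π)) = true := by decide +kernel
/-- block 5: `15·Jlow > 0` on entries `500..599`. -/
theorem chunk_5 : (chunk 5).all (fun π => decide (0 < J15 π)) = true := by decide +kernel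
/-- block 6: `15·Jlow > 0` on entries `600..699`. -/
theorem chunk_6 : (chunk 6).all (fun π => decide (0 < J15 π)) = true := by decide +kernel
/-- block 7: `15·Jlow > 0` on entries `700..799`. -/
theorem chunk_7 : (chunk 7).all (fun π => decide (0 < J15 π)) = true := by decide +kernel
/-- block 8: `15·Jlow > 0` on entries `800..828`. -/
theorem chunk_8 : (chunk 8).all (fun π => decide (0 < J15 π)) = true := by decide +kernel

/-- The list is the concatenation of its nine blocks. -/
theorem LIST_eq_chunks : LIST = chunk 0 ++ chunk 1 ++ chunk 2 ++ chunk 3 ++ chunk 4 ++ chunk 5 ++ chunk 6 ++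
    chunk 7 ++ chunk 8 := by decide +kernel

/-- **The finite check of 22.12.6**: `15·Jlow(π) > 0` for every `π ∈ LIST` (minimum `1976`). -/
theorem LIST_pos : LIST.all (fun π => decide (0 < J15 π)) = true := by
  rw [LIST_eq_chunks]
  simp only [List.all_append, chunk_0, chunk_1, chunk_2, chunk_3, chunk_4, chunk_5, chunk_6, chunk_7, chunk_8,
    Bool.and_self]

/-- `0 < J15 π` for every profile of the list. -/
theorem J15_pos_of_mem {π : CProf} (h : π ∈ LIST) : 0 < J15 π := by
  have := LIST_pos
  rw [List.all_eq_true] at this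
  have h' := this π h
  simpa using h'

end PercRepro.SixFour.PL
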